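import Summits.CriticalPhenomena.SAWScalingLimit.Theorems.SAWTotalPositivityCriticalBubbleBoundJoinSurgeryDefs
import Summits.CriticalPhenomena.SAWScalingLimit.Theorems.SAWTotalPositivityCriticalBubbleBoundJoinReplace

/-!
# Madras' modification, cases `B2a` and `C2a` (stubs `modify_spec_B2a`, `modify_spec_C2a` of line
`docking-census-joining`, crux stmt-CriticalPhenomena-7117
`Summit.CriticalPhenomena.SAWScalingLimit.Theses.SAWTotalPositivity.CriticalBubbleBound`)

The two "deep corner" cases of the local modification `modify E Y` of a polygon `E` of `ℤ²` at its
window `Y` (`…JoinSurgeryDefs.lean`): in case `B2a` the cell `c' = Y + (1, 2)` is a vertex of `E`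
whose right edge `s(c', Y + (2, 2))` is present, and that edge is replaced by the nine-edge path
`(1,2) → (1,1) → (1,0) → (1,-1) → (2,-1) → (3,-1) → (3,0) → (3,1) → (2,1) → (2,2)` (relative to `Y`)
down through the vertex-free right corridor `{Y + (s, t) : s ≥ 1, |t| ≤ 1}`; case `C2a` is its
mirror image in the row of `Y`. In both cases every interior site of the path is a corridor site,
so the generic edge-replacement lemma `isPolygon_replace_edge` (`…JoinReplace.lean`) applies; the
eight registered consequences (polygon, `+8` edges, the output vertical 2-segment in column
`Y 0 + 3`, the window bound, the vertex bookkeeping and the explicit inverse) are then read off.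

The file is organised around ONE private master statement `modify_spec_of_chain` for "a single
edge of `E` replaced by an explicit chain of relative sites whose interior lies in the corridor"
(the chain is traced by a lattice walk, `exists_chainWalk`), whose combinatorial side conditions
on the explicit list of relative sites are discharged by `decide` in each case.
Everything here is [folklore] bookkeeping for [cite: Hammond2015SAPJoining, §4.1].
-/

noncomputable section

open SimpleGraph
open Literature.Probability.LatticeModels
open Literature.Probability.RandomPlanarGeometry Literature.Probability.RandomPlanarGeometry.SAW
open scoped BigOperators
open Summit.CriticalPhenomena.SAWScalingLimit.Theorems.CriticalBubbleBound.Negative (e₀)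
open Summit.CriticalPhenomena.SAWScalingLimit.Theorems.CriticalBubbleBound.Docking

namespace Summit.CriticalPhenomena.SAWScalingLimit.Theorems.CriticalBubbleBound.Join

/-! ## Relative sites: injectivity, adjacency, chains of adjacent sites as lattice walks -/

/-- `d ↦ pt Y d = Y + d` is injective. [folklore] -/
private theorem pt_injective (Y : Site 2) : Function.Injective (pt Y) := by
  intro d d' h
  have h0 := congrFun h 0
  have h1 := congrFun h 1
  simp only [pt, Pi.add_apply, Matrix.cons_val_zero, Matrix.cons_val_one, add_right_inj] at h0 h1
  exact Prod.ext h0 h1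

/-- Coordinates of `pt Y d`. [folklore] -/
private theorem pt_apply (Y : Site 2) (d : ℤ × ℤ) : pt Y d 0 = Y 0 + d.1 ∧ pt Y d 1 = Y 1 + d.2 := by
  simp [pt]

/-- Adjacent relative sites (a unit step up, down, right or left, written out as the relation used
in the chains below) give adjacent lattice sites. [folklore] -/
private theorem adj_pt (Y : Site 2) {a b : ℤ × ℤ}
    (h : (b.1 = a.1 ∧ (b.2 = a.2 + 1 ∨ a.2 = b.2 + 1)) ∨ (b.2 = a.2 ∧ (b.1 = a.1 + 1 ∨ a.1 = b.1 + 1))) :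
    (zdGraph 2).Adj (pt Y a) (pt Y b) := by
  rw [Zd.zdGraph_adj_iff_sub]
  rcases h with ⟨h1, h2 | h2⟩ | ⟨h1, h2 | h2⟩
  · refine ⟨1, Or.inl ?_⟩
    funext i; fin_cases i <;> simp [pt, h1, h2]
  · refine ⟨1, Or.inr ?_⟩
    funext i; fin_cases i <;> simp [pt, h1, h2]
  · refine ⟨0, Or.inl ?_⟩
    funext i; fin_cases i <;> simp [pt, h1, h2]
  · refine ⟨0, Or.inr ?_⟩
    funext i; fin_cases i <;> simp [pt, h1, h2]

/-- A chain `a :: l` of adjacent relative sites is traced by a lattice walk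
`pt Y a → pt Y l₀ → pt Y l₁ → ⋯ → pt Y (last)` with the expected vertices, edges and length.
[folklore] -/
private theorem exists_chainWalk (Y : Site 2) : ∀ (a : ℤ × ℤ) (l : List (ℤ × ℤ)),
    (a :: l).IsChain (fun u v : ℤ × ℤ =>
      (v.1 = u.1 ∧ (v.2 = u.2 + 1 ∨ u.2 = v.2 + 1)) ∨ (v.2 = u.2 ∧ (v.1 = u.1 + 1 ∨ u.1 = v.1 + 1))) →
    ∃ P : (zdGraph 2).Walk (pt Y a) (pt Y ((a :: l).getLast (List.cons_ne_nil a l))),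
      P.support = (a :: l).map (pt Y) ∧
        P.edges = ((a :: l).zip l).map (fun p => s(pt Y p.1, pt Y p.2)) ∧ P.length = l.length
  | _, [], _ => ⟨Walk.nil, rfl, rfl, rfl⟩
  | a, b :: l, h => by
    obtain ⟨P, hs, he, hl⟩ := exists_chainWalk Y b l (List.isChain_cons_cons.1 h).2
    refine ⟨Walk.cons (adj_pt Y (List.isChain_cons_cons.1 h).1) P, ?_, ?_, ?_⟩
    · show pt Y a :: P.support = _
      rw [hs]
      rfl
    · show s(pt Y a, pt Y b) :: P.edges = _
      rw [he]
      rfl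
    · show P.length + 1 = _
      rw [hl]
      rfl

/-! ## The master statement: one edge replaced by a chain through the corridor -/

/-- **Single-edge corridor surgery.** Let `E` be a polygon whose right corridor at `Y` is
vertex-free, in case `c`, where case `c` removes the single edge `s(pt Y a, pt Y b) ∈ E` and adds
the chain `a :: l` from `a` to `b`: a self-avoiding chain of nine unit steps whose interior sites lie
in the corridor box, passing through the output 2-segment `(3,-1)–(3,0)–(3,1)`. Then `modify E Y` is
a polygon with `#E + 8` edges containing the output segment, its window-row vertices have abscissa
`≤ Y 0 + 3`, its vertices are vertices of `E` or new cells, every vertex of `E` survives, and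
`unmodify c` inverts it. [folklore] -/
private theorem modify_spec_of_chain {E : Finset (Sym2 (Site 2))} {Y : Site 2} {c : JCase}
    {a b : ℤ × ℤ} {l : List (ℤ × ℤ)}
    (hE : IsPolygon (zdGraph 2) E) (hc : caseOf E Y = c)
    (hcorr : ∀ s t : ℤ, 1 ≤ s → -1 ≤ t → t ≤ 1 → ¬ IsV E (Y + ![s, t]))
    (hab : s(pt Y a, pt Y b) ∈ E)
    (hpath : pathPts c = a :: l) (hrem : remPairs c = [(a, b)])
    (hch : (a :: l).IsChain (fun u v : ℤ × ℤ =>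
      (v.1 = u.1 ∧ (v.2 = u.2 + 1 ∨ u.2 = v.2 + 1)) ∨ (v.2 = u.2 ∧ (v.1 = u.1 + 1 ∨ u.1 = v.1 + 1))))
    (hlast : (a :: l).getLast (List.cons_ne_nil a l) = b)
    (hnd : (a :: l).Nodup) (hlen : l.length = 9)
    (hsplit : ∀ d ∈ a :: l, d = a ∨ d = b ∨ d ∈ l.dropLast)
    (hin : ∀ d ∈ l.dropLast, 1 ≤ d.1 ∧ d.1 ≤ 3 ∧ -1 ≤ d.2 ∧ d.2 ≤ 1)
    (hseg₁ : ((3, -1), (3, 0)) ∈ (a :: l).zip l ∨ ((3, 0), (3, -1)) ∈ (a :: l).zip l)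
    (hseg₂ : ((3, 0), (3, 1)) ∈ (a :: l).zip l ∨ ((3, 1), (3, 0)) ∈ (a :: l).zip l)
    (hends : ∀ q ∈ (a :: l).zip l, q.1 ∈ l.dropLast ∨ q.2 ∈ l.dropLast)
    (hcov : ∀ d ∈ [a, b], ∃ q ∈ (a :: l).zip l, d = q.1 ∨ d = q.2) :
    IsPolygon (zdGraph 2) (modify E Y) ∧ (modify E Y).card = E.card + 8 ∧
      s(pt Y (3, -1), pt Y (3, 0)) ∈ modify E Y ∧ s(pt Y (3, 0), pt Y (3, 1)) ∈ modify E Y ∧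
      (∀ p : Site 2, IsV (modify E Y) p → -1 ≤ p 1 - Y 1 → p 1 - Y 1 ≤ 1 → p 0 ≤ Y 0 + 3) ∧
      (∀ p : Site 2, IsV (modify E Y) p → IsV E p ∨ p ∈ newCells c Y) ∧
      (∀ p : Site 2, IsV E p → IsV (modify E Y) p) ∧ unmodify c (modify E Y) Y = E := by
  subst hlast
  -- notation-free abbreviations of the three explicit sets of the case
  have hA : addedE c Y = (((a :: l).zip l).map fun p => s(pt Y p.1, pt Y p.2)).toFinset := by
    rw [addedE, hpath]; rfl
  have hR : removedE c Y = {s(pt Y a, pt Y ((a :: l).getLast (List.cons_ne_nil a l)))} := by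
    rw [removedE, hrem]; simp
  have hN : newCells c Y = (l.dropLast.map (pt Y)).toFinset := by
    rw [newCells, hpath]; rfl
  have hmod : modify E Y =
      E.erase s(pt Y a, pt Y ((a :: l).getLast (List.cons_ne_nil a l))) ∪ addedE c Y := by
    rw [modify, hc, hR, Finset.sdiff_singleton_eq_erase]
  -- corridor sites are not vertices of `E`
  have hfresh : ∀ d : ℤ × ℤ, 1 ≤ d.1 ∧ d.1 ≤ 3 ∧ -1 ≤ d.2 ∧ d.2 ≤ 1 → ¬ IsV E (pt Y d) :=
    fun d h => hcorr d.1 d.2 h.1 h.2.2.1 h.2.2.2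
  -- the added edges, their vertices, and their disjointness from `E`
  have hzip : ∀ q ∈ (a :: l).zip l, s(pt Y q.1, pt Y q.2) ∈ addedE c Y := fun q hq => by
    rw [hA, List.mem_toFinset, List.mem_map]; exact ⟨q, hq, rfl⟩
  have hAv : ∀ p, IsV (addedE c Y) p → ∃ d ∈ a :: l, p = pt Y d := by
    rintro p ⟨e, he, hp⟩
    rw [hA, List.mem_toFinset, List.mem_map] at he
    obtain ⟨⟨u, v⟩, hq, rfl⟩ := he
    have huv := List.of_mem_zip hq
    rcases Sym2.mem_iff.1 hp with rfl | rfl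
    · exact ⟨u, huv.1, rfl⟩
    · exact ⟨v, List.mem_cons_of_mem _ huv.2, rfl⟩
  have hAE : ∀ e ∈ addedE c Y, e ∉ E := by
    intro e he heE
    rw [hA, List.mem_toFinset, List.mem_map] at he
    obtain ⟨q, hq, rfl⟩ := he
    rcases hends q hq with h | h
    · exact hfresh _ (hin _ h) ⟨_, heE, Sym2.mem_mk_left _ _⟩
    · exact hfresh _ (hin _ h) ⟨_, heE, Sym2.mem_mk_right _ _⟩
  -- the surgery
  obtain ⟨P, hPs, hPe, hPl⟩ := exists_chainWalk Y a l hch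
  have hP : P.IsPath := by rw [Walk.isPath_def, hPs]; exact hnd.map (pt_injective Y)
  have h2 : 2 ≤ P.length := by rw [hPl]; omega
  have hint : ∀ x ∈ P.support, x ≠ pt Y a →
      x ≠ pt Y ((a :: l).getLast (List.cons_ne_nil a l)) → ¬ ∃ e ∈ E, x ∈ e := by
    intro x hx hxa hxb
    rw [hPs, List.mem_map] at hx
    obtain ⟨d, hd, rfl⟩ := hx
    rcases hsplit d hd with rfl | rfl | hd'
    · exact absurd rfl hxa
    · exact absurd rfl hxb
    · exact hfresh d (hin d hd')
  obtain ⟨hpoly, hcard⟩ := isPolygon_replace_edge E _ _ P hE hab hP h2 hint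
  rw [hPe, ← hA] at hpoly hcard
  rw [hPl, hlen] at hcard
  -- (6) vertices of the modification, (5w) window bound for vertices of `E`
  have h6 : ∀ p : Site 2, IsV (modify E Y) p → IsV E p ∨ p ∈ newCells c Y := by
    rintro p ⟨e, he, hpe⟩
    rw [hmod, Finset.mem_union] at he
    rcases he with he | he
    · exact Or.inl ⟨e, Finset.mem_of_mem_erase he, hpe⟩
    · obtain ⟨d, hd, rfl⟩ := hAv p ⟨e, he, hpe⟩
      rcases hsplit d hd with rfl | rfl | hd'
      · exact Or.inl ⟨_, hab, Sym2.mem_mk_left _ _⟩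
      · exact Or.inl ⟨_, hab, Sym2.mem_mk_right _ _⟩
      · exact Or.inr (by rw [hN, List.mem_toFinset, List.mem_map]; exact ⟨d, hd', rfl⟩)
  have h5E : ∀ p : Site 2, IsV E p → -1 ≤ p 1 - Y 1 → p 1 - Y 1 ≤ 1 → p 0 ≤ Y 0 + 3 := by
    intro p hp h1 h2
    by_contra hlt
    refine hcorr (p 0 - Y 0) (p 1 - Y 1) (by omega) h1 h2 ?_
    convert hp using 2
    funext i; fin_cases i <;> simp
  refine ⟨hmod ▸ hpoly, by rw [hmod]; omega, ?_, ?_, ?_, h6, ?_, ?_⟩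
  · -- (3) lower output edge
    rw [hmod]
    refine Finset.mem_union_right _ (hseg₁.elim (hzip _) fun h => ?_)
    rw [Sym2.eq_swap]; exact hzip _ h
  · -- (4) upper output edge
    rw [hmod]
    refine Finset.mem_union_right _ (hseg₂.elim (hzip _) fun h => ?_)
    rw [Sym2.eq_swap]; exact hzip _ h
  · -- (5) window bound
    intro p hp h1 h2
    rcases h6 p hp with hpE | hpN
    · exact h5E p hpE h1 h2
    · rw [hN, List.mem_toFinset, List.mem_map] at hpN
      obtain ⟨d, hd, rfl⟩ := hpN
      have := (hin d hd).2.1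
      rw [(pt_apply Y d).1]; omega
  · -- (7) survival of the vertices of `E`
    rintro p ⟨e, he, hpe⟩
    rw [hmod]
    by_cases hea : e = s(pt Y a, pt Y ((a :: l).getLast (List.cons_ne_nil a l)))
    · subst hea
      have key : ∀ d ∈ [a, (a :: l).getLast (List.cons_ne_nil a l)],
          IsV (addedE c Y) (pt Y d) := by
        intro d hd
        obtain ⟨q, hq, hdq⟩ := hcov d hd
        refine ⟨_, hzip q hq, ?_⟩
        rcases hdq with rfl | rfl
        · exact Sym2.mem_mk_left _ _
        · exact Sym2.mem_mk_right _ _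
      rcases Sym2.mem_iff.1 hpe with rfl | rfl
      · obtain ⟨e, he', hpe'⟩ := key a (by simp)
        exact ⟨e, Finset.mem_union_right _ he', hpe'⟩
      · obtain ⟨e, he', hpe'⟩ := key ((a :: l).getLast (List.cons_ne_nil a l)) (by simp)
        exact ⟨e, Finset.mem_union_right _ he', hpe'⟩
    · exact ⟨e, Finset.mem_union_left _ (Finset.mem_erase.2 ⟨hea, he⟩), hpe⟩
  · -- (8) the explicit inverse
    rw [unmodify, hmod, hR]
    ext e
    simp only [Finset.mem_union, Finset.mem_sdiff, Finset.mem_erase, Finset.mem_singleton]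
    have h1 := hAE e
    have h2 : e = s(pt Y a, pt Y ((a :: l).getLast (List.cons_ne_nil a l))) → e ∈ E :=
      fun h => h ▸ hab
    tauto

/-! ## The two registered cases -/

/-- **Case `B2a` of Madras' modification.** If `E` is a polygon in case `B2a` at `Y` (the cell
`Y + (1,2)` is a vertex whose right edge is present) with vertex-free right corridor, then
`modify E Y` — that edge replaced by the nine-edge path down through the corridor — is a polygon
with `#E + 8` edges through the vertical 2-segment of column `Y 0 + 3`, with the stated vertex
bookkeeping, and `unmodify B2a` recovers `E`. [cite: Hammond2015SAPJoining, §4.1] -/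
theorem modify_spec_B2a : ∀ (E : Finset (Sym2 (Site 2))) (Y : Site 2), IsPolygon (zdGraph 2) E → caseOf E Y = JCase.B2a → (∀ s t : ℤ, 1 ≤ s → -1 ≤ t → t ≤ 1 → ¬ IsV E (Y + ![s, t])) → IsPolygon (zdGraph 2) (modify E Y) ∧ (modify E Y).card = E.card + 8 ∧ s(pt Y (3, -1), pt Y (3, 0)) ∈ modify E Y ∧ s(pt Y (3, 0), pt Y (3, 1)) ∈ modify E Y ∧ (∀ p : Site 2, IsV (modify E Y) p → -1 ≤ p 1 - Y 1 → p 1 - Y 1 ≤ 1 → p 0 ≤ Y 0 + 3) ∧ (∀ p : Site 2, IsV (modify E Y) p → IsV E p ∨ p ∈ newCells JCase.B2a Y) ∧ (∀ p : Site 2, IsV E p → IsV (modify E Y) p) ∧ unmodify JCase.B2a (modify E Y) Y = E := by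
  intro E Y hE hc hcorr
  have hab : s(pt Y (1, 2), pt Y (2, 2)) ∈ E := by
    have hc' := hc
    unfold caseOf at hc'
    split_ifs at hc'; assumption
  exact modify_spec_of_chain hE hc hcorr hab rfl rfl (by decide) (by rfl) (by decide) rfl
    (by decide) (by decide) (by decide) (by decide) (by decide) (by decide)

/-- **Case `C2a` of Madras' modification** (mirror image of `B2a` in the row of `Y`): the cell
`Y + (1,-2)` is a vertex whose right edge is present, and that edge is replaced by the nine-edge
path up through the corridor; same conclusions. [cite: Hammond2015SAPJoining, §4.1] -/
theorem modify_spec_C2a : ∀ (E : Finset (Sym2 (Site 2))) (Y : Site 2), IsPolygon (zdGraph 2) E → caseOf E Y = JCase.C2a → IsV E (Y - e₁) → (∀ s t : ℤ, 1 ≤ s → -1 ≤ t → t ≤ 1 → ¬ IsV E (Y + ![s, t])) → IsPolygon (zdGraph 2) (modify E Y) ∧ (modify E Y).card = E.card + 8 ∧ s(pt Y (3, -1), pt Y (3, 0)) ∈ modify E Y ∧ s(pt Y (3, 0), pt Y (3, 1)) ∈ modify E Y ∧ (∀ p : Site 2, IsV (modify E Y) p → -1 ≤ p 1 - Y 1 →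 p 1 - Y 1 ≤ 1 → p 0 ≤ Y 0 + 3) ∧ (∀ p : Site 2, IsV (modify E Y) p → IsV E p ∨ p ∈ newCells JCase.C2a Y) ∧ (∀ p : Site 2, IsV E p → IsV (modify E Y) p) ∧ unmodify JCase.C2a (modify E Y) Y = E := by
  intro E Y hE hc _ hcorr
  have hab : s(pt Y (1, -2), pt Y (2, -2)) ∈ E := by
    have hc' := hc
    unfold caseOf at hc'
    split_ifs at hc'; assumption
  exact modify_spec_of_chain hE hc hcorr hab rfl rfl (by decide) (by rfl) (by decide) rfl
    (by decide) (by decide) (by decide) (by decide) (by decide) (by decide)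

end Summit.CriticalPhenomena.SAWScalingLimit.Theorems.CriticalBubbleBound.Join

end
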